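import Summits.MatrixMultiplication.OmegaCensus.STPPVosperClash61Tools

/-!
# ω-census (abelian STPP census): tools for the DOUBLE Vosper clash in `ℤ₆₁` — runs of any length, tables with exceptional ratios (kernel)

HONEST FRAMING (pub-omega census; verbatim): lottery ticket; floor = certified bounds/negative ranges.
Census STRUCTURE tools (seat pub-omega-stpp-1 gen 29, 2026-08-28), family (b2); nothing here is progress on `ω`.  Customer:
`STPPVosperClash222234235.lean` — the last three-block doubly-N18-tight beating candidate at `61`, `{(2,2,2),(2,3,4),(2,3,5)}`, where ONE Vosper structure
is not enough: the window is `{0,…,46}`, the progression `Y° − A₃` has `17` terms, and the block-3 sumset is ten 3-runs (reading `(a,b,c)`) or six 5-runs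
(reading `(a,c,b)`, `isSTPP_negSwap`); each table ALONE leaves the ratio `j = e/e′ ∈ {±1, ±20}` (`±20`: one placement, `S = {0..5} ∪ {21..25} ∪ {41..46}`,
complement two 15-runs), and only the two readings together clash.  This file generalises `STPPVosperClash61Tools`:

* `dvd_card_filter_val_lt` — the PREFIX LAW for a disjoint union of `r`-runs inside a window `{0,…,n−1}` with `n + r ≤ 62`: `x ∉ T ⇒ r ∣ #{y ∈ T : y.val < x.val}`;
* `val_mem_of_nat_table` — the `ℤ₆₁` wrapper for ANY `(n, m, r)` and any target set `J` of ratios: the `ℕ`-table gives `j.val ∈ J`;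
* the two tables for `(n, m, r) = (47, 17, 3)` and `(47, 17, 5)` with `J = {0, 1, 60, 20, 41}` (`decide +kernel`, seconds);
* `step_eq_or_eq_neg_of_apFinset_two_eq` — two 2-term progressions with the same support have steps equal up to sign.

References: M. B. Nathanson, *Additive Number Theory: Inverse Problems*, GTM 165, §2.5.
-/

open Finset

namespace Summit.MatrixMultiplication.OmegaCensus.CubeNB

open Literature.Combinatorics.Additive

/-! ## The prefix law for runs of length `r` -/

section Prefix

/-- **Prefix law, runs of length `r`.**  In `ℤ₆₁` let `T = ⋃_{k ∈ s} {g k + i : i < r}` be a union of PAIRWISE DISJOINT `r`-runs inside the window `{0,…,n−1}`,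
`n + r ≤ 62` (no wrap-around).  For every `x ∉ T`, `r ∣ #{y ∈ T : y.val < x.val}`. [folklore] -/
theorem dvd_card_filter_val_lt {ι : Type*} (s : Finset ι) (g : ι → ZMod 61) {n r : ℕ} (hnr : n + r ≤ 62)
    (hdisj : (s : Set ι).PairwiseDisjoint fun k => apFinset (g k) 1 r)
    (hsub : ∀ k ∈ s, apFinset (g k) 1 r ⊆ apFinset 0 1 n) (x : ZMod 61)
    (hx : x ∉ s.biUnion fun k => apFinset (g k) 1 r) :
    r ∣ #((s.biUnion fun k => apFinset (g k) 1 r).filter fun y => y.val < x.val) := by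
  haveI : Fact (Nat.Prime 61) := ⟨prime_61⟩
  rcases Nat.eq_zero_or_pos r with rfl | hr
  · simp
  rw [Finset.filter_biUnion]
  have hdisj' : (s : Set ι).PairwiseDisjoint fun k => (apFinset (g k) 1 r).filter fun y => y.val < x.val :=
    hdisj.mono fun k => Finset.filter_subset _ _
  rw [Finset.card_biUnion hdisj']
  apply Finset.dvd_sum
  intro k hk
  have hn : n ≤ 61 := by omega
  have hgn : (g k).val < n :=
    (mem_apFinset_zero_one_iff hn).1 (hsub k hk (mem_apFinset.2 ⟨0, hr, by simp⟩))
  have hval : ∀ i, i < r → (g k + i • (1 : ZMod 61)).val = (g k).val + i := by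
    intro i hi
    rw [val_add_nsmul_zmod61, ZMod.val_one, one_mul, Nat.mod_eq_of_lt (by omega)]
  by_cases hlt : (g k).val < x.val
  · have hall : (apFinset (g k) 1 r).filter (fun y => y.val < x.val) = apFinset (g k) 1 r := by
      apply Finset.filter_true_of_mem
      intro y hy
      obtain ⟨i, hi, rfl⟩ := mem_apFinset.1 hy
      rw [hval i hi]
      by_contra hge
      rw [not_lt] at hge
      obtain ⟨i₀, hi₀⟩ : ∃ i₀, (g k).val + i₀ = x.val := ⟨x.val - (g k).val, by omega⟩
      have hi₀r : i₀ < r := by omega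
      have hxmem : x ∈ apFinset (g k) 1 r := by
        refine mem_apFinset.2 ⟨i₀, hi₀r, ZMod.val_injective 61 ?_⟩
        rw [hval i₀ hi₀r, hi₀]
      exact hx (Finset.mem_biUnion.2 ⟨k, hk, hxmem⟩)
    rw [hall, card_apFinset one_ne_zero (by omega)]
  · have hnone : (apFinset (g k) 1 r).filter (fun y => y.val < x.val) = ∅ := by
      apply Finset.filter_false_of_mem
      intro y hy
      obtain ⟨i, hi, rfl⟩ := mem_apFinset.1 hy
      rw [hval i hi]
      omega
    rw [hnone, Finset.card_empty]
    exact dvd_zero r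

end Prefix

/-! ## The `ℤ₆₁` wrapper for a general table -/

section Wrapper

/-- **From an `ℕ`-table to `ℤ₆₁`, general form.**  Given the table for `(window, terms, run length) = (n, m, r)` with target set `J`: if the `m`-term progression
`S = {t + i•j : i < m}` (`j ≠ 0`, `m ≤ 61`) lies in `{0,…,n−1}` (`n ≤ 61`) and `r ∣ x.val − #{y ∈ S : y.val < x.val}` at every `x ∈ S`, then `j.val ∈ J`.
[folklore] -/
theorem val_mem_of_nat_table {n m r : ℕ} {J : Finset ℕ} (hn : n ≤ 61) (hm : m ≤ 61)
    (htable : ∀ j < 61, ∀ t < 61, (∀ i < m, (t + j * i) % 61 < n) →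
      (∀ k < m, r ∣ (t + j * k) % 61 - #((range m).filter fun i => (t + j * i) % 61 < (t + j * k) % 61)) → j ∈ J)
    {t j : ZMod 61} (hj : j ≠ 0) (hSV : apFinset t j m ⊆ apFinset 0 1 n)
    (hgap : ∀ x ∈ apFinset t j m, r ∣ x.val - #((apFinset t j m).filter fun y => y.val < x.val)) : j.val ∈ J := by
  haveI : Fact (Nat.Prime 61) := ⟨prime_61⟩
  have hpos : ∀ i, i < m → (t.val + j.val * i) % 61 < n := by
    intro i hi
    rw [← val_add_nsmul_zmod61]
    exact (mem_apFinset_zero_one_iff hn).1 (hSV (mem_apFinset.2 ⟨i, hi, rfl⟩))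
  have hcount : ∀ c : ℕ, #((apFinset t j m).filter fun y => y.val < c) =
      #((range m).filter fun i => (t.val + j.val * i) % 61 < c) := by
    intro c
    have himg : apFinset t j m = (range m).image fun i : ℕ => t + i • j := rfl
    rw [himg, Finset.filter_image, Finset.card_image_of_injOn]
    · apply congrArg Finset.card
      apply Finset.filter_congr
      intro i _
      rw [val_add_nsmul_zmod61]
    · intro i hi i' hi' h
      have him := Finset.mem_range.1 (Finset.mem_filter.1 (Finset.mem_coe.1 hi)).1
      have him' := Finset.mem_range.1 (Finset.mem_filter.1 (Finset.mem_coe.1 hi')).1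
      exact zmod61_natMul_injOn hj (by omega) (by omega) h
  have hgap' : ∀ k, k < m → r ∣ (t.val + j.val * k) % 61 -
      #((range m).filter fun i => (t.val + j.val * i) % 61 < (t.val + j.val * k) % 61) := by
    intro k hk
    have h := hgap (t + k • j) (mem_apFinset.2 ⟨k, hk, rfl⟩)
    rwa [hcount, val_add_nsmul_zmod61] at h
  exact htable j.val j.val_lt t.val t.val_lt hpos hgap'

end Wrapper

/-! ## The two tables for the window `47`, seventeen terms, runs of length `3` and `5` -/

section Tables

/-- **Table `(47, 17, 3)` (kernel `decide`).**  For all `j, t < 61`: if the seventeen positions `(t + j·i) mod 61` lie in `[0,47)` and at each of them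
`3 ∣ position − #{earlier positions below it}`, then `j ∈ {0, 1, 60, 20, 41}` (`±1` and the exceptional `±20`). [folklore] -/
theorem step3_nat_47_17_r3 : ∀ j < 61, ∀ t < 61, (∀ i < 17, (t + j * i) % 61 < 47) →
    (∀ k < 17, 3 ∣ (t + j * k) % 61 - #((range 17).filter fun i => (t + j * i) % 61 < (t + j * k) % 61)) →
    j ∈ ({0, 1, 60, 20, 41} : Finset ℕ) := by
  decide +kernel

/-- **Table `(47, 17, 5)` (kernel `decide`).**  For all `j, t < 61`: if the seventeen positions `(t + j·i) mod 61` lie in `[0,47)` and at each of them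
`5 ∣ position − #{earlier positions below it}`, then `j ∈ {0, 1, 60, 20, 41}`. [folklore] -/
theorem step3_nat_47_17_r5 : ∀ j < 61, ∀ t < 61, (∀ i < 17, (t + j * i) % 61 < 47) →
    (∀ k < 17, 5 ∣ (t + j * k) % 61 - #((range 17).filter fun i => (t + j * i) % 61 < (t + j * k) % 61)) →
    j ∈ ({0, 1, 60, 20, 41} : Finset ℕ) := by
  decide +kernel

end Tables

/-! ## Two-term progressions -/

section TwoTerm

variable {p : ℕ} [hp : Fact p.Prime]

/-- Two 2-term progressions with the same support and nonzero steps have steps equal up to sign: `{a, a+f} = {a′, a′+g} ⇒ g = ±f`.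
[cite: Nathanson1996, §2.5] -/
theorem step_eq_or_eq_neg_of_apFinset_two_eq {a a' f g : ZMod p} (hg : g ≠ 0)
    (h : apFinset a f 2 = apFinset a' g 2) : g = f ∨ g = -f := by
  have hmem : ∀ x, x ∈ apFinset a' g 2 → x = a ∨ x = a + f := by
    intro x hx
    rw [← h] at hx
    obtain ⟨i, hi, rfl⟩ := mem_apFinset.1 hx
    interval_cases i
    · left; simp
    · right; simp
  have h0 : a' ∈ apFinset a' g 2 := mem_apFinset.2 ⟨0, by norm_num, by simp⟩
  have h1 : a' + g ∈ apFinset a' g 2 := mem_apFinset.2 ⟨1, by norm_num, by simp⟩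
  rcases hmem a' h0 with ha | ha <;> rcases hmem (a' + g) h1 with hb | hb
  · exact absurd (by linear_combination hb - ha) hg
  · left; linear_combination hb - ha
  · right; linear_combination hb - ha
  · exact absurd (by linear_combination hb - ha) hg

end TwoTerm

end Summit.MatrixMultiplication.OmegaCensus.CubeNB
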